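import Literature.Probability.Percolation.ConditionalPositiveAssociationProofs
import Literature.Probability.Percolation.StaticRenormalizationBoxes
import HarnessLib

/-!
# Critical percolation on slabs (Newman–Tassion–Wu 2017), 1/4 — definitions: the box-crossing event, linked events, the annulus product, the functionals of the two-source covariance inequality (re-homed)

**Newman–Tassion–Wu 2017 (critical percolation and the minimal spanning forest in slabs) — the named facts
`Literature.Probability.Percolation.NewmanTassionWu2017_thm31` (Theorem 3.1: the box-crossing property at `p_c(S_k)` for every slab
`S_k = ℤ² × {0,…,k}`, `SlabBoxCrossingProperty.lean`), `…NewmanTassionWu2017_thm24`, `…NewmanTassionWu2017_thm24_free` (Theorem 2.4: the free and wired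
minimal spanning forests of the slab coincide / every tree of the MSF is one-ended form used by the tree) and `…NewmanTassionWu2017_invasionMeet`
(§4: two invasion clusters meet), `SlabMSFStatement.lean`) HOLD — EXACT names `<fact>_holds` (this is file 1 of 4, the definitions file; the discharges are in files 3 and 4).**  [NewmanTassionWu2017]
C. M. Newman, V. Tassion, W. Wu, *Critical percolation and the minimal spanning tree in slabs*, Comm. Pure Appl. Math. **70** (2017) = arXiv:1512.09107.
Contents: (1, definitions file) the box-crossing event, linked events, the annulus product space, the functionals of the two-source inequality
(A2) behind the conditioned covariance transfer (clusters of a source set, `E`, `M`, `t`, `c`, `B`, `q`, `Y`, `X`; the push maps of the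
van den Berg–Häggström–Kahn induction) [VandenbergHaggstromKahn2005]; (2) toolkit theorems independent of those definitions: exit gates, slab transfer,
cube lemma, quantitative one-arm bounds, the covariance-transfer inequalities that do not mention the functionals, slab blocks and layer exits, square
crossings, the subcritical staircase, invasion percolation (greedy algorithm, locality, absorption), MSF scales / measurability / landing / surgery /
pieces / independence / counting, invasion trees; (3) the two-source inequality (A2) and COV(τ), RSW crossing bridges and the annulus two-arm separation,
the slab box-crossing walks / covering / criterion, NTW Thm. 3.14 Cases 1–2 and Lemma 3.16 (snap gadgets) and **Theorem 3.1**; (4) the corollaries of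
Theorem 3.1, MSF scales and independence, the gluing of invasion pieces and **Theorem 2.4 / §4**.
RE-HOMED into `Literature/` by the Hodge foundations lane (`lit-hodgefound`, seat p20, generation 40): verbatim DECLARATION-LEVEL ports (the 336
declarations needed, in dependency order; each Part is a slice of one Summits module) of 56 theorem modules
`Summits/CriticalPhenomena/PercolationContinuityZ3/Theorems/{PercAnnulusCrossing*,PercNearOneGluing*,SoloInformed*,PercNonProliferationSubpolynomialBlockingStubSlabTransfer,
StaircaseSlabSubcritical}.lean`; the namespace `Summit.CriticalPhenomena.PercolationContinuityZ3.Theorems` is re-rooted at `Literature.Probability.Percolation.SlabRSW`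
(sub-namespaces `Crossing`, `Rsw3`, `CovTau`, `SurfaceTension`, `SubpolynomialBlocking.StubSlabTransfer`, `Quant`, `CSH`, `SandwichBHK`, `CovTauStarN`,
`Transplant.StairSlabLog` kept); the four `_holds` theorems carry the EXACT names.  Built on the tree's Literature layer
(`Literature/Probability/Percolation/{Slab*,RSW*,GMSlabPercolation,ConditionalPositiveAssociationProofs,InvasionPercolation*,…}`, `Literature/Probability/LatticeModels/*`).
No new named fact (D-0026); imports Mathlib/Literature only; every declaration carries the citation of the printed statement it formalises or serves.
The Summits originals stay in place (transitional duplication).  WHAT THIS IS NOT: nothing here bears on the continuity of the percolation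
probability in `ℤ³` or any summit statement; it is the published slab theory of [NewmanTassionWu2017] re-proved in the tree's vocabulary.
-/

noncomputable section

/-!
## Part 1 — port of `Summits/CriticalPhenomena/PercolationContinuityZ3/Theorems/PercAnnulusCrossingBoxCrossingDefs.lean` (1 declarations kept)

# The box-crossing event `boxCross L i` of `ℤ^d`: an open left–right crossing of the box `Λ(L)` in the coordinate direction `i`

Declarations of this Part (verbatim port; each keeps its own docstring and citation): `boxCross`.

Reference keys (see `references.bib` and the declarations' citations): [Kesten1982].
-/

section Part1

namespace Literature.Probability.Percolation.SlabRSW.Crossing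

open _root_.MeasureTheory Literature.Probability.LatticeModels Literature.Probability.Percolation

/-- **Kesten's `i`-crossing event of the block `[0, L]`.**  For `L : ℤ^d` (side vector) and a direction
`i : Fin d`: some vertex `x` of the block `Finset.Icc 0 L = ∏_j {0, …, L_j}` on the face `{x_i = 0}` is joined to
some vertex `y` on the opposite face `{y_i = L_i}` by an open path all of whose vertices lie in the block (free
boundary conditions).  Discrete-block form of Kesten's Def. 3.1–3.3 (there paths live in the open continuum block
and only touch the faces at their endpoints; for nearest-neighbour `ℤ^d` the two versions define the same
crossing probabilities up to replacing `L_j` by `L_j ± 1` in the transverse directions, which is immaterial for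
every statement below).  For `d = 3`, `L = ![n,n,n]`, `i = 0` the complement is the event of
`PercAnnulusCrossing.CubeBlockingSeed`. [cite: Kesten1982, §3.3 Def. 1–3 and (3.32)] -/
def boxCross {d : ℕ} (L : Site d) (i : Fin d) : Set (BondConfig (Site d)) :=
  {ω | ∃ x ∈ Finset.Icc (0 : Site d) L, ∃ y ∈ Finset.Icc (0 : Site d) L,
    x i = 0 ∧ y i = L i ∧ ω ∈ openConnIn (↑(Finset.Icc (0 : Site d) L) : Set (Site d)) x y}

end Literature.Probability.Percolation.SlabRSW.Crossing

end Part1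

/-!
## Part 2 — port of `Summits/CriticalPhenomena/PercolationContinuityZ3/Theorems/SoloInformedLinkedEvents.lean` (1 declarations kept)

# Linking events `linked S A B` and translated box crossings on the grid `(2L+1)ℤ^d`

Declarations of this Part (verbatim port; each keeps its own docstring and citation): `linked`.

Reference keys (see `references.bib` and the declarations' citations): [NewmanTassionWu2017].
-/

section Part2

namespace Literature.Probability.Percolation.SlabRSW

open _root_.MeasureTheory _root_.ProbabilityTheory _root_.Filter _root_.Topology
open Literature.Probability.Percolation Literature.Probability.LatticeModels
open scoped _root_.ENNReal

namespace SurfaceTension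

variable {d : ℕ}

/-- `A ↔ B in S`: some site of `A` is joined to some site of `B` by an open lattice path inside
`S` (a union of the events `inConn S a b` of the static-renormalisation toolbox).
[cite: NewmanTassionWu2017, §3 (supporting lemma)] -/
def linked (S A B : Set (Site d)) : Set (BondConfig (Site d)) :=
  ⋃ a ∈ A, ⋃ b ∈ B, inConn S a b

end SurfaceTension

end Literature.Probability.Percolation.SlabRSW

end Part2

/-!
## Part 3 — port of `Summits/CriticalPhenomena/PercolationContinuityZ3/Theorems/SoloInformedAnnulusProduct.lean` (1 declarations kept)

# The annulus `Λ(b) ∖ Λ(a)` of `ℤ^d`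

Declarations of this Part (verbatim port; each keeps its own docstring and citation): `annulus`.

Reference keys (see `references.bib` and the declarations' citations): [NewmanTassionWu2017].
-/

section Part3

namespace Literature.Probability.Percolation.SlabRSW

open _root_.MeasureTheory _root_.ProbabilityTheory _root_.Filter _root_.Topology
open Literature.Probability.Percolation Literature.Probability.LatticeModels
open scoped _root_.ENNReal

namespace SurfaceTension

variable {d : ℕ}

/-- The annulus `Λ(b) ∖ Λ(a)` as a set of sites. [cite: NewmanTassionWu2017, §3 (supporting lemma)] -/
def annulus (a b : ℕ) : Set (Site d) := {x | x ∈ box d b ∧ x ∉ box d a}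

end SurfaceTension

end Literature.Probability.Percolation.SlabRSW

end Part3

/-!
## Part 4 — port of `Summits/CriticalPhenomena/PercolationContinuityZ3/Theorems/PercNearOneGluingNoHeavyLowerTailCSHPhi.lean` (1 declarations kept)

# The edge set `edgesOf K` touching a vertex set `K` (the graph `G − K` of the van den Berg–Häggström–Kahn induction)

Declarations of this Part (verbatim port; each keeps its own docstring and citation): `edgesOf`.

Reference keys (see `references.bib` and the declarations' citations): [VandenbergHaggstromKahn2005].
-/

section Part4

namespace Literature.Probability.Percolation.SlabRSW

open _root_.MeasureTheory _root_.Set Literature.Probability.LatticeModels Literature.Probability.Percolation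
open scoped _root_.Classical

namespace CSH

variable {V : Type*}

/-- The pairs meeting the vertex set `K` (deleting them is "percolation off `K`", i.e. on `G − K`).
[cite: VandenbergHaggstromKahn2005, §1 p. 4 (the graph `G − Z`)] -/
def edgesOf (K : Set V) : Set (Sym2 V) := {e | ∃ u ∈ e, u ∈ K}

end CSH

end Literature.Probability.Percolation.SlabRSW

end Part4

/-!
## Part 5 — port of `Summits/CriticalPhenomena/PercolationContinuityZ3/Theorems/PercNearOneGluingNoHeavyLowerTailCovTauA2Defs.lean` (11 declarations kept)

# The functionals of the two-source inequality (A2) behind the conditioned covariance transfer COV(τ) — finite-sum framework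

Declarations of this Part (verbatim port; each keeps its own docstring and citation): `sC`, `rest`, `oInd`, `Ef`, `Mf`, `tf`, `cf`, `Bf`, `qf`, `Yf`, `Xf`.

Reference keys (see `references.bib` and the declarations' citations): [VandenbergHaggstromKahn2005].
-/

section Part5

namespace Literature.Probability.Percolation.SlabRSW.CovTau

open Literature.Probability.Percolation
open Literature.Probability.Percolation.BHK2006
open Literature.Probability.Percolation.DecisionTree (ind ind_of_mem ind_of_not_mem ind_nonneg)
open scoped _root_.Classical

variable {V : Type*}

/-- The vertex cluster `C_N` of the source SET `N` in the percolation restricted to `U`: the vertices joined to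
some `z ∈ N` by an open path inside `U` (every `z ∈ N` belongs to it).
[cite: VandenbergHaggstromKahn2005, §1 p. 3 (clusters of the restricted model)] -/
def sC (U : Finset V) (N : Set V) (ω : Set (Sym2 V)) : Set V :=
  {u | ∃ z ∈ N, (openGraph (ω ∩ edgesIn U)).Reachable z u}

/-- The vertex set `U ∖ C_N` of the "world" left after deleting the cluster of `N` (a `Finset`).
[cite: VandenbergHaggstromKahn2005, §1 p. 4 (the induced model on `G` minus a vertex set)] -/
def rest (U : Finset V) (N : Set V) (ω : Set (Sym2 V)) : Finset V := U.filter fun u => u ∉ sC U N ω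

/-- `1{o ∈ C_v}` as a (monotone) function of the open EDGE cluster of `v`. [cite: VandenbergHaggstromKahn2005, §1 p. 3] -/
def oInd (o v : V) (C : Set (Sym2 V)) : ℝ := ind {C : Set (Sym2 V) | o = v ∨ ∃ e ∈ C, o ∈ e} C

variable [Fintype V]

/-- `E(N) = μ_{G[U]}(o ↔ v, v ↮ x, v ↮ N)`. [cite: VandenbergHaggstromKahn2005, §1 p. 3] -/
def Ef (w : Sym2 V → ℝ) (U : Finset V) (x o v : V) (N : Set V) : ℝ :=
  ∑ ω, weight w ω * (oInd o v (rC U v ω) * ind (rD U v (insert x N)) ω)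

/-- `M(N) = μ_{G[U]}(v ↮ x, v ↮ N)`. [cite: VandenbergHaggstromKahn2005, §1 p. 3] -/
def Mf (w : Sym2 V → ℝ) (U : Finset V) (x v : V) (N : Set V) : ℝ :=
  ∑ ω, weight w ω * ind (rD U v (insert x N)) ω

/-- `t = E_{G[U]} Ψ(C_x)`. [cite: VandenbergHaggstromKahn2005, §1 p. 3] -/
def tf (w : Sym2 V → ℝ) (U : Finset V) (x : V) (Ψ : Set V → ℝ) : ℝ :=
  ∑ ω, weight w ω * Ψ (sC U ({x} : Set V) ω)

/-- `c = μ_{G[U]}(x ↔ v)`. [cite: VandenbergHaggstromKahn2005, §1 p. 3] -/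
def cf (w : Sym2 V → ℝ) (U : Finset V) (x v : V) : ℝ :=
  ∑ ω, weight w ω * ind {ω : Set (Sym2 V) | (openGraph (ω ∩ edgesIn U)).Reachable x v} ω

/-- `B = Cov_{G[U]}(Ψ(C_x), 1{v ∈ C_x})`.
[cite: VandenbergHaggstromKahn2005, §1 p. 6 (Harris' inequality)] -/
def Bf (w : Sym2 V → ℝ) (U : Finset V) (x v : V) (Ψ : Set V → ℝ) : ℝ :=
  (∑ ω, weight w ω * (Ψ (sC U ({x} : Set V) ω) *
      ind {ω : Set (Sym2 V) | (openGraph (ω ∩ edgesIn U)).Reachable x v} ω)) - tf w U x Ψ * cf w U x v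

/-- `q = μ_{G[U]}(o ↔ v | v ↮ x) = E(∅)/M(∅)`. [cite: VandenbergHaggstromKahn2005, §1 p. 3] -/
def qf (w : Sym2 V → ℝ) (U : Finset V) (x o v : V) : ℝ := Ef w U x o v ∅ / Mf w U x v ∅

/-- `Y(N) = E[ B(C_N) ; x ∉ C_N ]` with `B(W)` the covariance in the world `G[U ∖ W]`.
[cite: VandenbergHaggstromKahn2005, §1 p. 4] -/
def Yf (w : Sym2 V → ℝ) (U : Finset V) (x v : V) (Ψ : Set V → ℝ) (N : Set V) : ℝ :=
  ∑ ω, weight w ω * (Bf w (rest U N ω) x v Ψ * ind (rD U x N) ω)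

/-- `X(N) = E[ q(C_N)·B(C_N) ; x ∉ C_N ]`. [cite: VandenbergHaggstromKahn2005, §1 p. 4] -/
def Xf (w : Sym2 V → ℝ) (U : Finset V) (x o v : V) (Ψ : Set V → ℝ) (N : Set V) : ℝ :=
  ∑ ω, weight w ω * (qf w (rest U N ω) x o v * Bf w (rest U N ω) x v Ψ * ind (rD U x N) ω)

end Literature.Probability.Percolation.SlabRSW.CovTau

end Part5

/-!
## Part 6 — port of `Summits/CriticalPhenomena/PercolationContinuityZ3/Theorems/PercNearOneGluingNoHeavyLowerTailCovTauA2Push.lean` (5 declarations kept)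

# The law of BHK's neighbour set `S` is a product law

Declarations of this Part (verbatim port; each keeps its own docstring and citation): `piZ`, `pZ`, `rST`, `pT`, `toggle`.

Reference keys (see `references.bib` and the declarations' citations): [VandenbergHaggstromKahn2005].
-/

section Part6

namespace Literature.Probability.Percolation.SlabRSW.CovTau

open Literature.Probability.Percolation
open Literature.Probability.Percolation.BHK2006
open Literature.Probability.Percolation.DecisionTree (ind ind_of_mem ind_of_not_mem ind_nonneg)
open scoped _root_.Classical

variable {V : Type*} [Fintype V]

/-- The probability that `u` has an open edge to `Z`. [cite: VandenbergHaggstromKahn2005, §1 p. 4 ("the law of `S` is a product measure")] -/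
def piZ (w : Sym2 V → ℝ) (Z : Finset V) (u : V) : ℝ :=
  ∑ ω, weight w ω * ind {ω : Set (Sym2 V) | ∃ z ∈ Z, s(u, z) ∈ ω} ω

/-- The parameters of the product law of `S = rS U Z ·` on `Set V`: `p_u = piZ w Z u` for `u ∈ U ∖ Z`, else `0`.
[cite: VandenbergHaggstromKahn2005, §1 p. 4 ("the law of `S` is a product measure")] -/
def pZ (w : Sym2 V → ℝ) (U Z : Finset V) (u : V) : ℝ := if u ∈ U \ Z then piZ w Z u else 0

/-- The partial neighbour set `S_T = {n ∈ T | n has an open edge to Z}` (so `rS U Z = S_{U∖Z}`). [cite: VandenbergHaggstromKahn2005, §1 p. 4 ("the law of `S` is a product measure")] -/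
def rST (T Z : Finset V) (ω : Set (Sym2 V)) : Set V := {n | n ∈ T ∧ ∃ z ∈ Z, s(n, z) ∈ ω}

/-- Its product parameters: `piZ` on `T`, `0` elsewhere. [cite: VandenbergHaggstromKahn2005, §1 p. 4 ("the law of `S` is a product measure")] -/
def pT (w : Sym2 V → ℝ) (T Z : Finset V) (u : V) : ℝ := if u ∈ T then piZ w Z u else 0

/-- Toggling the membership of `u`. [cite: VandenbergHaggstromKahn2005, §1 p. 4 ("the law of `S` is a product measure")] -/
def toggle (u : V) (η : Set V) : Set V := if u ∈ η then η \ {u} else insert u η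

end Literature.Probability.Percolation.SlabRSW.CovTau

end Part6

/-!
## Part 7 — port of `Summits/CriticalPhenomena/PercolationContinuityZ3/Theorems/PercNearOneGluingNoHeavyLowerTailCovTauStarNPrelim.lean` (1 declarations kept)

# The indicator `hr x v` of `{x ↔ v}` on finite configurations

Declarations of this Part (verbatim port; each keeps its own docstring and citation): `hr`.

Reference keys (see `references.bib` and the declarations' citations): [NewmanTassionWu2017].
-/

section Part7

namespace Literature.Probability.Percolation.SlabRSW

namespace CovTauStarN

open _root_.Finset _root_.MeasureTheory Literature.Probability.Percolation Literature.Probability.Percolation.DecisionTree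
open Literature.Probability.LatticeModels (prodBernoulli)
open scoped _root_.Classical

section Functionals

variable {V : Type*} [Fintype V] [DecidableEq V]

/-- The indicator of `{x ↔ v}` on finite configurations. [cite: NewmanTassionWu2017, §3 (supporting lemma)] -/
def hr (x v : V) (K : Finset (Sym2 V)) : ℝ :=
  ind {L : Finset (Sym2 V) | (openGraph (↑L : Set (Sym2 V))).Reachable x v} K

variable (Ψ : Set (Sym2 V) → ℝ) (x v : V) (N : Finset V)

end Functionals

end CovTauStarN

end Literature.Probability.Percolation.SlabRSW

end Part7

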